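import Summits.ResolutionOfSingularities.ResolutionOfSingularities.Theorems.PurelyInseparableDim4ChartAtlasSNCFarRepairAlgebra
import Summits.ResolutionOfSingularities.ResolutionOfSingularities.Theorems.PurelyInseparableDim4ChartAtlasSNCJacobianIndexed
import HarnessLib

/-!
# Purely inseparable four-folds `z^p + F(x₁, …, x₄)`: AFTER THE FAR-RESONANCE REPAIR the escaping centre is snc with the whole boundary read on the
# `y_j`-chart of `Bl_Σ` (S3-N2 repair, far class, step 3; cell `res-dim4-pi`, typ-2 g6)

[OURS · counted 0] (D-0157 DOOR 2; DR-157-C; desk WORD #115 (a)/(c), #131 (c); crit-3 g5's (b)). Steps 1–2 (p706678, p707037): the resonance locus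
`Σ = V(y_0, y_T, y_j)` is snc with the translated boundary, and after ANY blowing up of `Σ` the strict transform of the escaping centre reads
`V(y_0, y_T)` on the `y_j`-chart only, where the members read: hyperplanes (the old ones containing `Σ`, the new exceptional `y_j·𝒪`, the old
`E₁ = {y_j = c'}`, those of indices outside `Σ`'s variables), PRODUCT QUADRICS `PQ_{m,a} = (y_j·y_m + a)·𝒪` (`m ∈ {0} ∪ T⁺`, `a ≠ 0`), RESONANT
STRICT TRANSFORMS `g_k = (y_k·(y_j - c') + b_k)·𝒪`, CUBICS `CU_k = ((y_j·y_k + b_k)·y_j - c'·y_j·y_k + e_k)·𝒪` (`k ∈ T` non-resonant) and the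
untouched `TQ_m` (`m ∉ T`). PROVED here (no `sorry`, no new axiom):

* **`hasSNCWith_𝓘Λ_of_forall_mem_after_farRepair`** — `V(y_0, y_T)` IS SNC WITH EVERY SUCH LIST as soon as the surviving far members keep
  pairwise distinct heights (`e_k·b_k' ≠ e_k'·b_k` for active cubics) and no hyperplane of index `j` sits at a cubic's height (`e_k ≠ a·b_k`; for
  the two that occur, `a = 0` and `a = -c'`, this is `e_k ≠ 0`, `d_k ≠ 0`) — NO condition on the resonant members any more.

Method: the indexed engine p707152 (owners/ranks per index: hyperplane ↦ its variable (0); active cubic (`y_k ∈ 𝔭`) ↦ `y_j` (1); `PQ_{m,a} ↦ y_m`,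
`g_k ↦ y_k` (2); other cubics `↦ y_k`, `TQ_m ↦ y_m` (3)) fed with the algebra p-`…SNCFarRepairAlgebra`. With steps 1–2 this is the chart-model form
of «blow up the resonance locus first, then the escaping centre is admissible» — the far analogue of N3+N5+N6 (p691715, p693365, p694533); the
W′-level statement (N7/N8 analogue) is the next file. Nothing here is a statement about resolution of singularities in dimension ≥ 4 / characteristic
`p` (NOT proved anywhere in this programme). bears_on: LADDER-RESOLUTION:D157-DOOR2 (res-dim4-pi). Supports stmt-ResolutionOfSingularities-16155
(helper, S3-N2 far repair).
-/

-- every declaration of this summit lives under `Summit.ResolutionOfSingularities.ResolutionOfSingularities`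
-- (summit = problem), which the duplicate-namespace linter flags; house convention (cf. the Target file).
set_option linter.dupNamespace false

noncomputable section

open MvPolynomial CategoryTheory AlgebraicGeometry Opposite TopologicalSpace
open AlgebraicGeometry.Scheme.IdealSheafData (ofIdealTop)

namespace Summit.ResolutionOfSingularities.ResolutionOfSingularities.Theorems.PIDim4

open Literature.AlgebraicGeometry.Resolution
open Literature.AlgebraicGeometry.Resolution.AffinePointBlowup (P A γ coord Wtop ξ)

namespace ChartDictionary

variable {K : Type} [Field K] {T : Finset (Fin 4)} {j : Fin 4} {b e : Fin 4 → K} {c' : K}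

/-- **AFTER THE FAR-RESONANCE REPAIR, THE ESCAPING CENTRE `V(y_0, y_T)` IS SNC WITH THE WHOLE BOUNDARY OF THE `y_j`-CHART.** `j ∉ T`, `c' ≠ 0`.
Members: `⊤`; hyperplanes `(y_m + a)·𝒪`, `(m, a) ∈ H`, with `a = 0` when `m ∈ {0} ∪ T⁺`, `a = b_m` when `m⁺` is the index of a `TQ`, and no
index-`j` hyperplane at a cubic's height; product quadrics `(y_j·y_m + a)·𝒪`, `(m, a) ∈ HP`, `m ∈ {0} ∪ T⁺`, `a ≠ 0`, with `a = b_k` when `m = k⁺`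
carries a `g_k` or `CU_k`; resonant strict transforms `g_k`, `k ∈ R ⊆ T`, `b_k ≠ 0`; cubics `CU_k`, `k ∈ N ⊆ T`, `e_k ≠ 0`, `e_k + b_k·c' ≠ 0`,
pairwise distinct heights; `TQ_m`, `m ∈ M`, `m ∉ T`, `m ≠ j`, `e_m + b_m·c' ≠ 0`. -/
theorem hasSNCWith_𝓘Λ_of_forall_mem_after_farRepair (hjT : j ∉ T) (hc' : c' ≠ 0) (H HP : Finset (Fin (4 + 1) × K)) (R N M : Finset (Fin 4))
    (hH : ∀ ma ∈ H, ma.1 ∈ (insert 0 (Fin.succ '' (T : Set (Fin 4))) : Set (Fin (4 + 1))) → ma.2 = 0)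
    (hHM : ∀ m ∈ M, ∀ a : K, (m.succ, a) ∈ H → a = b m)
    (hHj : ∀ a : K, (j.succ, a) ∈ H → ∀ k ∈ N, b k ≠ 0 → e k ≠ a * b k)
    (hHP : ∀ ma ∈ HP, ma.1 ∈ (insert 0 (Fin.succ '' (T : Set (Fin 4))) : Set (Fin (4 + 1))) ∧ ma.2 ≠ 0)
    (hHPb : ∀ k ∈ R ∪ N, ∀ a : K, (k.succ, a) ∈ HP → a = b k)
    (hR : ∀ k ∈ R, k ∈ T ∧ b k ≠ 0) (hN : ∀ k ∈ N, k ∈ T ∧ e k ≠ 0 ∧ e k + b k * c' ≠ 0)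
    (hNh : ∀ k ∈ N, ∀ k' ∈ N, k ≠ k' → b k ≠ 0 → b k' ≠ 0 → e k * b k' ≠ e k' * b k)
    (hM : ∀ m ∈ M, m ∉ T ∧ m ≠ j ∧ e m + b m * c' ≠ 0)
    {E : List (Scheme.IdealSheafData (P 4 K))}
    (hE : ∀ D ∈ E, D = ⊤ ∨ (∃ ma ∈ H, D = ofIdealTop (Ideal.span {(γ 4 K).symm (X ma.1 + C ma.2)})) ∨
      (∃ ma ∈ HP, D = ofIdealTop (Ideal.span {(γ 4 K).symm (X j.succ * X ma.1 + C ma.2)})) ∨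
      (∃ k ∈ R, D = ofIdealTop (Ideal.span {(γ 4 K).symm (X k.succ * (X j.succ - C c') + C (b k))})) ∨
      (∃ k ∈ N, D = ofIdealTop (Ideal.span {(γ 4 K).symm ((X j.succ * X k.succ + C (b k)) * X j.succ - C c' * (X j.succ * X k.succ) + C (e k))})) ∨
      ∃ m ∈ M, D = ofIdealTop (Ideal.span {(γ 4 K).symm ((X m.succ + C (b m)) * X j.succ - C c' * X m.succ + C (e m))})) :
    HasSNCWith E (AffineCoordBlowup.𝓘Λ 4 K (insert 0 (Fin.succ '' (T : Set (Fin 4))))) := by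
  classical
  set Λ : Set (Fin (4 + 1)) := insert 0 (Fin.succ '' (T : Set (Fin 4))) with hΛ
  have hmemΛ : ∀ i : Fin 4, i.succ ∈ Λ ↔ i ∈ T := fun i => succ_mem_centreVars_iff T i
  have hjΛ : j.succ ∉ Λ := fun h => hjT ((hmemΛ j).mp h)
  let f : (Fin (4 + 1) × K) ⊕ (Fin (4 + 1) × K) ⊕ Fin 4 ⊕ Fin 4 ⊕ Fin 4 → A 4 K :=
    Sum.elim (fun ma => X ma.1 + C ma.2) (Sum.elim (fun ma => X j.succ * X ma.1 + C ma.2) (Sum.elim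
      (fun k => X k.succ * (X j.succ - C c') + C (b k)) (Sum.elim
      (fun k => (X j.succ * X k.succ + C (b k)) * X j.succ - C c' * (X j.succ * X k.succ) + C (e k))
      (fun m => (X m.succ + C (b m)) * X j.succ - C c' * X m.succ + C (e m)))))
  let I : Finset ((Fin (4 + 1) × K) ⊕ (Fin (4 + 1) × K) ⊕ Fin 4 ⊕ Fin 4 ⊕ Fin 4) := H.disjSum (HP.disjSum (R.disjSum (N.disjSum M)))
  let Λf : Finset (Fin (4 + 1)) := insert 0 (T.image Fin.succ)
  let G : Finset ((Fin (4 + 1) × K) ⊕ (Fin (4 + 1) × K) ⊕ Fin 4 ⊕ Fin 4 ⊕ Fin 4) := Λf.image fun m => Sum.inl (m, 0)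
  have hΛf : ∀ m, m ∈ Λf ↔ m ∈ Λ := by
    intro m
    simp only [Λf, Finset.mem_insert, Finset.mem_image, hΛ, Set.mem_insert_iff, Set.mem_image, Finset.mem_coe]
  have hGmem : ∀ a, a ∈ G ↔ ∃ m ∈ Λ, a = Sum.inl (m, 0) := by
    intro a
    simp only [G, Finset.mem_image, hΛf]
    exact ⟨fun ⟨m, hm, h⟩ => ⟨m, hm, h.symm⟩, fun ⟨m, hm, h⟩ => ⟨m, hm, h.symm⟩⟩
  have hG𝔭 : ∀ x : P 4 K, (∀ g ∈ G, f g ∈ x.asIdeal) ↔ ∀ m ∈ Λ, (X m : A 4 K) ∈ x.asIdeal := by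
    intro x
    constructor
    · intro h m hm
      have := h _ ((hGmem _).mpr ⟨m, hm, rfl⟩)
      simpa [f] using this
    · intro h g hg
      obtain ⟨m, hm, rfl⟩ := (hGmem g).mp hg
      simpa [f] using h m hm
  have hspan : Ideal.span (f '' (G : Set _)) = Ideal.span (X '' Λ) := by
    congr 1
    ext q
    constructor
    · rintro ⟨g, hg, rfl⟩
      obtain ⟨m, hm, rfl⟩ := (hGmem g).mp (Finset.mem_coe.mp hg)
      exact ⟨m, hm, by simp [f]⟩
    · rintro ⟨m, hm, rfl⟩
      exact ⟨Sum.inl (m, 0), Finset.mem_coe.mpr ((hGmem _).mpr ⟨m, hm, rfl⟩), by simp [f]⟩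
  let v : P 4 K → (Fin (4 + 1) × K) ⊕ (Fin (4 + 1) × K) ⊕ Fin 4 ⊕ Fin 4 ⊕ Fin 4 → Fin (4 + 1) := fun x =>
    Sum.elim (fun ma => ma.1) (Sum.elim (fun ma => ma.1) (Sum.elim (fun k => k.succ) (Sum.elim
      (fun k => if (X k.succ : A 4 K) ∈ x.asIdeal then j.succ else k.succ) (fun m => m.succ))))
  let ρ : P 4 K → (Fin (4 + 1) × K) ⊕ (Fin (4 + 1) × K) ⊕ Fin 4 ⊕ Fin 4 ⊕ Fin 4 → ℕ := fun x =>
    Sum.elim (fun _ => 0) (Sum.elim (fun _ => 2) (Sum.elim (fun _ => 2) (Sum.elim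
      (fun k => if (X k.succ : A 4 K) ∈ x.asIdeal then 1 else 3) (fun _ => 3))))
  have hfamily : ∀ (x : P 4 K) a, (a ∈ I ∧ f a ∈ x.asIdeal ∨ a ∈ G ∧ ∀ g ∈ G, f g ∈ x.asIdeal) → f a ∈ x.asIdeal ∧
      ((∃ ma, a = Sum.inl ma ∧ (ma ∈ H ∨ ma.2 = 0 ∧ ma.1 ∈ Λ ∧ ∀ m ∈ Λ, (X m : A 4 K) ∈ x.asIdeal)) ∨
       (∃ ma ∈ HP, a = Sum.inr (Sum.inl ma)) ∨ (∃ k ∈ R, a = Sum.inr (Sum.inr (Sum.inl k))) ∨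
       (∃ k ∈ N, a = Sum.inr (Sum.inr (Sum.inr (Sum.inl k)))) ∨ ∃ m ∈ M, a = Sum.inr (Sum.inr (Sum.inr (Sum.inr m)))) := by
    rintro x a (⟨haI, ha𝔭⟩ | ⟨haG, hall⟩)
    · refine ⟨ha𝔭, ?_⟩
      simp only [I, Finset.mem_disjSum] at haI
      rcases haI with ⟨ma, hma, rfl⟩ | ⟨_, haI, rfl⟩
      · exact Or.inl ⟨ma, rfl, Or.inl hma⟩
      rcases haI with ⟨ma, hma, rfl⟩ | ⟨_, haI, rfl⟩
      · exact Or.inr (Or.inl ⟨ma, hma, rfl⟩)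
      rcases haI with ⟨k, hk, rfl⟩ | ⟨_, haI, rfl⟩
      · exact Or.inr (Or.inr (Or.inl ⟨k, hk, rfl⟩))
      rcases haI with ⟨k, hk, rfl⟩ | ⟨m, hm, rfl⟩
      · exact Or.inr (Or.inr (Or.inr (Or.inl ⟨k, hk, rfl⟩)))
      · exact Or.inr (Or.inr (Or.inr (Or.inr ⟨m, hm, rfl⟩)))
    · obtain ⟨m, hm, rfl⟩ := (hGmem a).mp haG
      exact ⟨hall _ haG, Or.inl ⟨(m, 0), rfl, Or.inr ⟨rfl, hm, (hG𝔭 x).mp hall⟩⟩⟩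
  refine hasSNCWith_𝓘Λ_of_jacobian_indexed E Λ I G f hspan ?_ ρ v ?_ ?_
  · -- the members
    intro D hD
    rcases hE D hD with h | ⟨ma, hma, h⟩ | ⟨ma, hma, h⟩ | ⟨k, hk, h⟩ | ⟨k, hk, h⟩ | ⟨m, hm, h⟩
    · exact Or.inl h
    · exact Or.inr ⟨Sum.inl ma, by simp [I, hma], h⟩
    · exact Or.inr ⟨Sum.inr (Sum.inl ma), by simp [I, hma], h⟩
    · exact Or.inr ⟨Sum.inr (Sum.inr (Sum.inl k)), by simp [I, hk], h⟩
    · exact Or.inr ⟨Sum.inr (Sum.inr (Sum.inr (Sum.inl k))), by simp [I, hk], h⟩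
    · exact Or.inr ⟨Sum.inr (Sum.inr (Sum.inr (Sum.inr m))), by simp [I, hm], h⟩
  · -- diagonal
    intro x a ha
    obtain ⟨ha𝔭, hshape⟩ := hfamily x a ha
    rcases hshape with ⟨ma, rfl, -⟩ | ⟨ma, hma, rfl⟩ | ⟨k, hk, rfl⟩ | ⟨k, hk, rfl⟩ | ⟨m, hm, rfl⟩
    · change pderiv ma.1 (X ma.1 + C ma.2 : A 4 K) ∉ x.asIdeal
      rw [pderiv_X_add_C, if_pos rfl]
      exact fun h1 => x.2.ne_top ((Ideal.eq_top_iff_one _).mpr h1)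
    · obtain ⟨hm, ha⟩ := hHP ma hma
      have hmj : ma.1 ≠ j.succ := fun h => hjΛ (h ▸ hm)
      change pderiv ma.1 (X j.succ * X ma.1 + C ma.2 : A 4 K) ∉ x.asIdeal
      rw [pderiv_pquadric_self hmj]
      exact (X_not_mem_of_pquadric_mem x ha ha𝔭).1
    · obtain ⟨hkT, hbk⟩ := hR k hk
      have hkj : k ≠ j := fun h => hjT (h ▸ hkT)
      change pderiv k.succ (X k.succ * (X j.succ - C c') + C (b k) : A 4 K) ∉ x.asIdeal
      rw [pderiv_resonant_self hkj]
      exact (not_mem_of_resonant_mem x hbk ha𝔭).1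
    · obtain ⟨hkT, hek, hd⟩ := hN k hk
      have hkj : k ≠ j := fun h => hjT (h ▸ hkT)
      change pderiv (if (X k.succ : A 4 K) ∈ x.asIdeal then j.succ else k.succ)
        ((X j.succ * X k.succ + C (b k)) * X j.succ - C c' * (X j.succ * X k.succ) + C (e k) : A 4 K) ∉ x.asIdeal
      by_cases hXk : (X k.succ : A 4 K) ∈ x.asIdeal
      · rw [if_pos hXk, pderiv_cubic_j hkj]
        exact (cubic_active x hek ha𝔭 hXk).2.2
      · rw [if_neg hXk, pderiv_cubic_self hkj]
        exact X_j_mul_not_mem_of_cubic_mem x hek hd ha𝔭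
    · obtain ⟨-, hmj, hd⟩ := hM m hm
      change pderiv m.succ ((X m.succ + C (b m)) * X j.succ - C c' * X m.succ + C (e m) : A 4 K) ∉ x.asIdeal
      rw [pderiv_tquadric_self hmj]
      exact X_sub_C_not_mem_of_tquadric_mem x hd ha𝔭
  · -- triangularity
    intro x a a' ha ha' hne hρle
    obtain ⟨ha𝔭, hshape⟩ := hfamily x a ha
    obtain ⟨ha'𝔭, hshape'⟩ := hfamily x a' ha'
    rcases hshape with ⟨ma, rfl, hma⟩ | ⟨ma, hma, rfl⟩ | ⟨k, hk, rfl⟩ | ⟨k, hk, rfl⟩ | ⟨m, hm, rfl⟩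
    · ----------------------------------------------------------------- `a` a hyperplane `y_m + a₀`
      change pderiv (v x a') (X ma.1 + C ma.2 : A 4 K) ∈ x.asIdeal
      rw [pderiv_X_add_C]
      split_ifs with ho
      swap
      · exact x.asIdeal.zero_mem
      exfalso
      rcases hshape' with ⟨ma', rfl, -⟩ | ⟨ma', hma', rfl⟩ | ⟨k', hk', rfl⟩ | ⟨k', hk', rfl⟩ | ⟨m', hm', rfl⟩
      · -- two hyperplanes of one index through one point are equal
        change ma'.1 = ma.1 at ho
        have := X_add_C_eq_of_mem_of_mem x (k := ma.1) (a := ma.2) (a' := ma'.2) ha𝔭 (by rw [← ho]; exact ha'𝔭)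
        exact hne (by rw [show ma = ma' from Prod.ext ho.symm this])
      · -- a product quadric owns `y_m`, `m ∈ Λ`: the hyperplane `y_m` (constant `0`) kills it
        change ma'.1 = ma.1 at ho
        obtain ⟨hm', ha'⟩ := hHP ma' hma'
        have h0 : ma.2 = 0 := by
          rcases hma with h | ⟨h, -⟩
          · exact hH ma h (ho ▸ hm')
          · exact h
        have hX : (X ma'.1 : A 4 K) ∈ x.asIdeal := by rw [ho]; simpa [f, h0] using ha𝔭
        exact (X_not_mem_of_pquadric_mem x ha' ha'𝔭).2 hX
      · -- `g_k` owns `y_k`, `k ∈ T`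
        change k'.succ = ma.1 at ho
        obtain ⟨hk'T, hbk'⟩ := hR k' hk'
        have h0 : ma.2 = 0 := by
          rcases hma with h | ⟨h, -⟩
          · exact hH ma h (ho ▸ (hmemΛ k').mpr hk'T)
          · exact h
        have hX : (X k'.succ : A 4 K) ∈ x.asIdeal := by rw [ho]; simpa [f, h0] using ha𝔭
        exact (not_mem_of_resonant_mem x hbk' ha'𝔭).2 hX
      · -- a cubic: owner `y_j` (active) or `y_k`
        obtain ⟨hk'T, hek', -⟩ := hN k' hk'
        have hk'j : k' ≠ j := fun h => hjT (h ▸ hk'T)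
        change (if (X k'.succ : A 4 K) ∈ x.asIdeal then j.succ else k'.succ) = ma.1 at ho
        by_cases hXk : (X k'.succ : A 4 K) ∈ x.asIdeal
        · rw [if_pos hXk] at ho
          have hmaH : ma ∈ H := by
            rcases hma with h | ⟨-, h, -⟩
            · exact h
            · exact absurd (ho ▸ h) hjΛ
          obtain ⟨-, hbk', -⟩ := cubic_active x hek' ha'𝔭 hXk
          have hq : (X j.succ + C ma.2 : A 4 K) ∈ x.asIdeal := by rw [ho]; exact ha𝔭
          exact hHj ma.2 (by rw [ho]; exact hmaH) k' hk' hbk' (height_eq_of_X_j_add_C_mem_cubic x hek' ha'𝔭 hXk hq)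
        · rw [if_neg hXk] at ho
          have h0 : ma.2 = 0 := by
            rcases hma with h | ⟨h, -⟩
            · exact hH ma h (ho ▸ (hmemΛ k').mpr hk'T)
            · exact h
          exact hXk (by rw [ho]; simpa [f, h0] using ha𝔭)
      · -- `TQ_m` owns `y_m`: a hyperplane of that index is the near member `y_m + b_m`
        change m'.succ = ma.1 at ho
        obtain ⟨-, -, hd'⟩ := hM m' hm'
        have hmaH : ma ∈ H := by
          rcases hma with h | ⟨-, h, -⟩
          · exact h
          · exact absurd ((hmemΛ m').mp (ho ▸ h)) (hM m' hm').1
        have hb : ma.2 = b m' := hHM m' hm' ma.2 (by rw [ho]; exact hmaH)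
        exact X_add_C_not_mem_of_tquadric_mem x hd' ha'𝔭 (by rw [ho, ← hb]; exact ha𝔭)
    · ----------------------------------------------------------------- `a` a product quadric (rank 2)
      obtain ⟨hm, ha0⟩ := hHP ma hma
      have hmj : ma.1 ≠ j.succ := fun h => hjΛ (h ▸ hm)
      rcases hshape' with ⟨ma', rfl, -⟩ | ⟨ma', hma', rfl⟩ | ⟨k', hk', rfl⟩ | ⟨k', hk', rfl⟩ | ⟨m', hm', rfl⟩
      · exfalso; change (2 : ℕ) ≤ 0 at hρle; omega
      · change pderiv ma'.1 (X j.succ * X ma.1 + C ma.2 : A 4 K) ∈ x.asIdeal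
        by_cases hmm : ma'.1 = ma.1
        · exfalso
          have := pquadric_const_eq_of_mem_of_mem x (m := ma.1) (a := ma.2) (a' := ma'.2) ha𝔭 (by rw [← hmm]; exact ha'𝔭)
          exact hne (by rw [show ma = ma' from Prod.ext hmm.symm this])
        · have hm'j : ma'.1 ≠ j.succ := fun h => hjΛ (h ▸ (hHP ma' hma').1)
          rw [pderiv_pquadric_of_ne (j := j) hmm hm'j]
          exact x.asIdeal.zero_mem
      · change pderiv k'.succ (X j.succ * X ma.1 + C ma.2 : A 4 K) ∈ x.asIdeal
        obtain ⟨hk'T, hbk'⟩ := hR k' hk'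
        have hk'j : k' ≠ j := fun h => hjT (h ▸ hk'T)
        by_cases hkm : k'.succ = ma.1
        · exfalso
          have hma2 : (k'.succ, ma.2) ∈ HP := by rw [show (k'.succ, ma.2) = ma from Prod.ext hkm rfl]; exact hma
          have hb : ma.2 = b k' := hHPb k' (Finset.mem_union_left _ hk') ma.2 hma2
          have hq : (X j.succ * X k'.succ + C (b k') : A 4 K) ∈ x.asIdeal := by rw [hkm, ← hb]; exact ha𝔭
          exact not_mem_of_resonant_mem_of_pquadric_mem x hbk' hc' ha'𝔭 hq
        · rw [pderiv_pquadric_of_ne (j := j) hkm (fun h => hk'j (Fin.succ_injective _ h))]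
          exact x.asIdeal.zero_mem
      · obtain ⟨hk'T, hek', hd'⟩ := hN k' hk'
        have hk'j : k' ≠ j := fun h => hjT (h ▸ hk'T)
        change pderiv (if (X k'.succ : A 4 K) ∈ x.asIdeal then j.succ else k'.succ) (X j.succ * X ma.1 + C ma.2 : A 4 K) ∈ x.asIdeal
        by_cases hXk : (X k'.succ : A 4 K) ∈ x.asIdeal
        · exfalso
          change (2 : ℕ) ≤ (if (X k'.succ : A 4 K) ∈ x.asIdeal then 1 else 3) at hρle
          rw [if_pos hXk] at hρle; omega
        · rw [if_neg hXk]
          by_cases hkm : k'.succ = ma.1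
          · exfalso
            have hma2 : (k'.succ, ma.2) ∈ HP := by rw [show (k'.succ, ma.2) = ma from Prod.ext hkm rfl]; exact hma
            have hb : ma.2 = b k' := hHPb k' (Finset.mem_union_right _ hk') ma.2 hma2
            have hq : (X j.succ * X k'.succ + C (b k') : A 4 K) ∈ x.asIdeal := by rw [hkm, ← hb]; exact ha𝔭
            exact cubic_not_mem_of_pquadric_mem x hd' hq ha'𝔭
          · rw [pderiv_pquadric_of_ne (j := j) hkm (fun h => hk'j (Fin.succ_injective _ h))]
            exact x.asIdeal.zero_mem
      · obtain ⟨hm'T, hm'j, -⟩ := hM m' hm'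
        change pderiv m'.succ (X j.succ * X ma.1 + C ma.2 : A 4 K) ∈ x.asIdeal
        have hm'm : m'.succ ≠ ma.1 := fun h => hm'T ((hmemΛ m').mp (h ▸ hm))
        rw [pderiv_pquadric_of_ne (j := j) hm'm (fun h => hm'j (Fin.succ_injective _ h))]
        exact x.asIdeal.zero_mem
    · ----------------------------------------------------------------- `a = g_k` (rank 2)
      obtain ⟨hkT, hbk⟩ := hR k hk
      have hkj : k ≠ j := fun h => hjT (h ▸ hkT)
      rcases hshape' with ⟨ma', rfl, -⟩ | ⟨ma', hma', rfl⟩ | ⟨k', hk', rfl⟩ | ⟨k', hk', rfl⟩ | ⟨m', hm', rfl⟩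
      · exfalso; change (2 : ℕ) ≤ 0 at hρle; omega
      · change pderiv ma'.1 (X k.succ * (X j.succ - C c') + C (b k) : A 4 K) ∈ x.asIdeal
        obtain ⟨hm', -⟩ := hHP ma' hma'
        by_cases hkm : ma'.1 = k.succ
        · exfalso
          have hma2 : (k.succ, ma'.2) ∈ HP := by rw [show (k.succ, ma'.2) = ma' from Prod.ext hkm.symm rfl]; exact hma'
          have hb : ma'.2 = b k := hHPb k (Finset.mem_union_left _ hk) ma'.2 hma2
          have hq : (X j.succ * X k.succ + C (b k) : A 4 K) ∈ x.asIdeal := by rw [← hkm, ← hb]; exact ha'𝔭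
          exact not_mem_of_resonant_mem_of_pquadric_mem x hbk hc' ha𝔭 hq
        · have hm'j : ma'.1 ≠ j.succ := fun h => hjΛ (h ▸ hm')
          rw [pderiv_resonant_of_ne (j := j) hkm hm'j]
          exact x.asIdeal.zero_mem
      · change pderiv k'.succ (X k.succ * (X j.succ - C c') + C (b k) : A 4 K) ∈ x.asIdeal
        have hkk : k'.succ ≠ k.succ := fun h => hne (by rw [Fin.succ_injective _ h])
        have hk'j : k' ≠ j := fun h => hjT (h ▸ (hR k' hk').1)
        rw [pderiv_resonant_of_ne (j := j) hkk (fun h => hk'j (Fin.succ_injective _ h))]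
        exact x.asIdeal.zero_mem
      · obtain ⟨hk'T, hek', -⟩ := hN k' hk'
        have hk'j : k' ≠ j := fun h => hjT (h ▸ hk'T)
        change pderiv (if (X k'.succ : A 4 K) ∈ x.asIdeal then j.succ else k'.succ) (X k.succ * (X j.succ - C c') + C (b k) : A 4 K) ∈ x.asIdeal
        by_cases hXk : (X k'.succ : A 4 K) ∈ x.asIdeal
        · exfalso
          change (2 : ℕ) ≤ (if (X k'.succ : A 4 K) ∈ x.asIdeal then 1 else 3) at hρle
          rw [if_pos hXk] at hρle; omega
        · rw [if_neg hXk]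
          by_cases hkk : k'.succ = k.succ
          · exfalso
            have hkk' : k' = k := Fin.succ_injective _ hkk
            subst hkk'
            exact cubic_not_mem_of_resonant_mem x hek' ha𝔭 ha'𝔭
          · rw [pderiv_resonant_of_ne (j := j) hkk (fun h => hk'j (Fin.succ_injective _ h))]
            exact x.asIdeal.zero_mem
      · obtain ⟨hm'T, hm'j, -⟩ := hM m' hm'
        change pderiv m'.succ (X k.succ * (X j.succ - C c') + C (b k) : A 4 K) ∈ x.asIdeal
        have hm'k : m'.succ ≠ k.succ := fun h => hm'T ((Fin.succ_injective _ h) ▸ hkT)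
        rw [pderiv_resonant_of_ne (j := j) hm'k (fun h => hm'j (Fin.succ_injective _ h))]
        exact x.asIdeal.zero_mem
    · ----------------------------------------------------------------- `a = CU_k` (rank 1 active / 3)
      obtain ⟨hkT, hek, hd⟩ := hN k hk
      have hkj : k ≠ j := fun h => hjT (h ▸ hkT)
      have hρk : ρ x (Sum.inr (Sum.inr (Sum.inr (Sum.inl k)))) = if (X k.succ : A 4 K) ∈ x.asIdeal then 1 else 3 := rfl
      rcases hshape' with ⟨ma', rfl, -⟩ | ⟨ma', hma', rfl⟩ | ⟨k', hk', rfl⟩ | ⟨k', hk', rfl⟩ | ⟨m', hm', rfl⟩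
      · exfalso; change (if (X k.succ : A 4 K) ∈ x.asIdeal then 1 else 3) ≤ 0 at hρle; split_ifs at hρle <;> omega
      · change pderiv ma'.1 ((X j.succ * X k.succ + C (b k)) * X j.succ - C c' * (X j.succ * X k.succ) + C (e k) : A 4 K) ∈ x.asIdeal
        obtain ⟨hm', ha'⟩ := hHP ma' hma'
        by_cases hkm : ma'.1 = k.succ
        · exfalso
          have hq' : (X j.succ * X k.succ + C ma'.2 : A 4 K) ∈ x.asIdeal := by rw [← hkm]; exact ha'𝔭
          by_cases hXk : (X k.succ : A 4 K) ∈ x.asIdeal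
          · exact pquadric_not_mem_of_X_mem x ha' hXk hq'
          · have hma2 : (k.succ, ma'.2) ∈ HP := by rw [show (k.succ, ma'.2) = ma' from Prod.ext hkm.symm rfl]; exact hma'
            have hb : ma'.2 = b k := hHPb k (Finset.mem_union_right _ hk) ma'.2 hma2
            exact cubic_not_mem_of_pquadric_mem x hd (by rw [← hb]; exact hq') ha𝔭
        · have hm'j : ma'.1 ≠ j.succ := fun h => hjΛ (h ▸ hm')
          rw [pderiv_cubic_of_ne (j := j) hkm hm'j]
          exact x.asIdeal.zero_mem
      · change pderiv k'.succ ((X j.succ * X k.succ + C (b k)) * X j.succ - C c' * (X j.succ * X k.succ) + C (e k) : A 4 K) ∈ x.asIdeal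
        obtain ⟨-, hbk'⟩ := hR k' hk'
        by_cases hkk : k'.succ = k.succ
        · exfalso
          have hkk' : k' = k := Fin.succ_injective _ hkk
          subst hkk'
          exact cubic_not_mem_of_resonant_mem x hek ha'𝔭 ha𝔭
        · have hk'j : k' ≠ j := fun h => hjT (h ▸ (hR k' hk').1)
          rw [pderiv_cubic_of_ne (j := j) hkk (fun h => hk'j (Fin.succ_injective _ h))]
          exact x.asIdeal.zero_mem
      · obtain ⟨hk'T, hek', -⟩ := hN k' hk'
        have hk'j : k' ≠ j := fun h => hjT (h ▸ hk'T)
        have hkk' : k ≠ k' := fun h => hne (by rw [h])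
        change pderiv (if (X k'.succ : A 4 K) ∈ x.asIdeal then j.succ else k'.succ)
          ((X j.succ * X k.succ + C (b k)) * X j.succ - C c' * (X j.succ * X k.succ) + C (e k) : A 4 K) ∈ x.asIdeal
        by_cases hXk' : (X k'.succ : A 4 K) ∈ x.asIdeal
        · rw [if_pos hXk']
          exfalso
          have hXk : (X k.succ : A 4 K) ∈ x.asIdeal := by
            by_contra h
            change (if (X k.succ : A 4 K) ∈ x.asIdeal then 1 else 3) ≤ (if (X k'.succ : A 4 K) ∈ x.asIdeal then 1 else 3) at hρle
            rw [if_neg h, if_pos hXk'] at hρle; omega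
          obtain ⟨-, hbk, -⟩ := cubic_active x hek ha𝔭 hXk
          obtain ⟨-, hbk', -⟩ := cubic_active x hek' ha'𝔭 hXk'
          exact hNh k hk k' hk' hkk' hbk hbk' (height_eq_of_cubic_mem_of_cubic_mem x hek hek' ha𝔭 hXk ha'𝔭 hXk')
        · rw [if_neg hXk', pderiv_cubic_of_ne (j := j) (fun h => hkk' (Fin.succ_injective _ h).symm) (fun h => hk'j (Fin.succ_injective _ h))]
          exact x.asIdeal.zero_mem
      · obtain ⟨hm'T, hm'j, -⟩ := hM m' hm'
        change pderiv m'.succ ((X j.succ * X k.succ + C (b k)) * X j.succ - C c' * (X j.succ * X k.succ) + C (e k) : A 4 K) ∈ x.asIdeal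
        have hm'k : m'.succ ≠ k.succ := fun h => hm'T ((Fin.succ_injective _ h) ▸ hkT)
        rw [pderiv_cubic_of_ne (j := j) hm'k (fun h => hm'j (Fin.succ_injective _ h))]
        exact x.asIdeal.zero_mem
    · ----------------------------------------------------------------- `a = TQ_m` (rank 3)
      obtain ⟨hmT, hmj, hd⟩ := hM m hm
      rcases hshape' with ⟨ma', rfl, -⟩ | ⟨ma', hma', rfl⟩ | ⟨k', hk', rfl⟩ | ⟨k', hk', rfl⟩ | ⟨m', hm', rfl⟩
      · exfalso; change (3 : ℕ) ≤ 0 at hρle; omega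
      · exfalso; change (3 : ℕ) ≤ 2 at hρle; omega
      · exfalso; change (3 : ℕ) ≤ 2 at hρle; omega
      · obtain ⟨hk'T, -, -⟩ := hN k' hk'
        have hk'j : k' ≠ j := fun h => hjT (h ▸ hk'T)
        change pderiv (if (X k'.succ : A 4 K) ∈ x.asIdeal then j.succ else k'.succ)
          ((X m.succ + C (b m)) * X j.succ - C c' * X m.succ + C (e m) : A 4 K) ∈ x.asIdeal
        by_cases hXk' : (X k'.succ : A 4 K) ∈ x.asIdeal
        · exfalso
          change (3 : ℕ) ≤ (if (X k'.succ : A 4 K) ∈ x.asIdeal then 1 else 3) at hρle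
          rw [if_pos hXk'] at hρle; omega
        · have hk'm : k'.succ ≠ m.succ := fun h => hmT ((Fin.succ_injective _ h) ▸ hk'T)
          rw [if_neg hXk', pderiv_tquadric_of_ne (j := j) hk'm (fun h => hk'j (Fin.succ_injective _ h))]
          exact x.asIdeal.zero_mem
      · obtain ⟨-, hm'j, -⟩ := hM m' hm'
        have hmm : m ≠ m' := fun h => hne (by rw [h])
        change pderiv m'.succ ((X m.succ + C (b m)) * X j.succ - C c' * X m.succ + C (e m) : A 4 K) ∈ x.asIdeal
        rw [pderiv_tquadric_of_ne (j := j) (fun h => hmm (Fin.succ_injective _ h).symm) (fun h => hm'j (Fin.succ_injective _ h))]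
        exact x.asIdeal.zero_mem

end ChartDictionary

end Summit.ResolutionOfSingularities.ResolutionOfSingularities.Theorems.PIDim4

end
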